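import Summits.BirchSwinnertonDyer.Rank1Residual.Additive.RamifiedSevenGenusNumberFieldColumnTwo
import Literature.NumberTheory.GaloisRepresentations.TateLevelOneWildOdd
import Literature.NumberTheory.EllipticCurves.CyclotomicZpExtension
import Literature.NumberTheory.EllipticCurves.SelmerPInftyRelModelAction
import Literature.NumberTheory.EllipticCurves.Gross2004.RationalCharacterFrobeniusProofs
import Literature.NumberTheory.LFunctions.NormDirichletCharacter
import Mathlib.NumberTheory.DirichletCharacter.Basic
import Mathlib.FieldTheory.Finite.Basic
import HarnessLib

set_option autoImplicit false

/-!
# `𝒞₇` genus road (crux `EllipticUnitValueSevenOfGZK`, K7r), row (K2C-4) block (X-a), file 1 of 3: THE DIRICHLET AVATAR OF A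
# LAYER CHARACTER — a continuous `χ : Γ_L → ℂˣ` trivial on `Gal(L̄/L_{n+1})` (the `(n+1)`-st layer of the cyclotomic
# `ℤ_p`-tower of a quadratic field `L`) IS `χ_ℚ ∘ χ_{p^{n+2}}` for a Dirichlet character `χ_ℚ` mod `p^{n+2}`, PRIMITIVE as
# soon as `χ` takes a primitive `p^{n+1}`-th root of unity as a value; and then `χ(𝔞) = χ_ℚ(N𝔞)` on the ideals prime to `p`

Cell bsd-cm, seat bsd-cm-prr-ty1 g32 (literature-prover), SUMMON `wake/SUMMON-bsd-cm-prr-ty1-20260830T2007Z.md` (planner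
bsd-cm-plan g36, D945; key K2C-4), block (X-a) «THE DICTIONARY DISCHARGE», move (2) CHARACTERS of p784707's docstring, and
STATUS CHECK (ART) of this seat.  HONEST LABEL: THEOREMS ONLY — no `def`, no named fact, no typed hypothesis, no instance, no
notation, no `sorry`; general odd prime `p` and any quadratic (Galois) `L`.  Consumed by file 3
(`RamifiedSevenGenusHeckeTwistDictionary`) at `p = 7`, `L = Φ.Kcm`.  stmt-BirchSwinnertonDyer-19945 is OPEN;
`X12.CMRamifiedSeven` NOT proved; no summit statement is proved by this seat; BSD is claimed for no curve.

## What is proved (numbers, not adjectives)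

* §0 `heckeIdealValue_eq_idealPow` — the tree's extended-by-zero ideal value `heckeIdealValue χ 𝔞` (`RankinSelbergLFunctionK`)
  IS `LFunctions.idealPow K (heckeValueAt χ) 𝔞` for `𝔞 ≠ 0` (exponent bookkeeping `Ideal.count_associates_factors_eq`);
  `idealPow_congr_of_dvd`.
* §1 THE KERNEL `apply_eq_one_of_pow_eq_one` — for a cyclotomic `ℤ_p`-datum `κ` of `ℚ` (`p` odd) restricted to `L`
  (`κ.restrictOfFinrankEqTwo`), a `χ` trivial on `layerSubgroup (n+1)` kills every `σ ∈ Γ_L` with `χ_{p^{n+2}}(σ)^{p−1} = 1`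
  (`σ^{p−1} ∈ Gal(L̄/L_{n+1})` by this lineage's `NumberFieldColumn.mem_layerSubgroup_restrict_of_dvd_cyclotomicCharacter_sub_one`
  (p785484) read through `modNCyclotomicCharacter_eq_toZModPow_cyclotomicCharacter`; `σ^{p^{n+1}} ∈ Gal(L̄/L_{n+1})`;
  `gcd(p−1, p^{n+1}) = 1`).
* §2 THE AVATAR `exists_dirichletCharacter` — `∃ θ : DirichletCharacter ℂ (p^{n+2})`, trivial on the `(p−1)`-torsion, with
  `χ σ = θ (modNCyclotomicCharacter L (p^{n+2}) σ)` for ALL `σ ∈ Γ_L`: `θ(a) = χ(σ_a)` for any `σ_a ∈ Γ_L` restricting to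
  `τ_a^E`, `χ_N(τ_a) = a` (`GaloisRep.exists_cyclotomicCharacter_toZModPow_eq`), `E` even with `E ≡ 1 (mod p^{n+1})`
  (`exists_exponent`; even powers of `Γ_ℚ` are restrictions from `Γ_L`, `RelModel.pow_finrank_mem_galRange`) — well defined
  and multiplicative by THE KERNEL.
* §3 PRIMITIVITY ⟺ ORDER `isPrimitive_of_isPrimitiveRoot` — if some `χ(γ)` is a primitive `p^{n+1}`-th root of unity then `θ`
  is primitive (conductor `p^j`, `j ≤ n+1` ⇒ `θ` kills `χ_N(γ)^{p^n(p−1)}` (`φ(p^{n+1}) = p^n(p−1)`, Mathlib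
  `factorsThrough_iff_ker_unitsMap`) ⇒ `χ(γ)^{p^n(p−1)} = 1`, but `p^{n+1} ∤ p^n(p−1)`).
* §4 FROBENIUS `heckeValueAt_eq_normCharValue`, `heckeIdealValue_eq` — `χ` is unramified off `p`
  (`modNCyclotomicCharacter_eq_one_of_mem_inertia`), `heckeValueAt χ v = θ(N v) = normCharValue θ v` for `v ∌ p`
  (`Gross2004.heckeValueAt_eq_of_isUnramifiedAt` + `modNCyclotomicCharacter_eq_residueCard_of_isArithFrobAt`: Artin reciprocity
  for `L(μ_N)/L` through the norm), hence `heckeIdealValue χ 𝔞 = θ(N𝔞)` for `𝔞 ≠ 0` prime to `p` (`idealPow_normCharValue`).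

## References
L. C. Washington, *Introduction to Cyclotomic Fields* (1997) §13.1 (`Gal(ℚ_n/ℚ) ≅ ℤ/p^n`, `ℚ_n ⊂ ℚ(μ_{p^{n+1}})`, `K·ℚ_∞`),
Ch. 3 pp. 19–21 (Dirichlet characters as Galois characters; conductor and ramification), Thm. 2.5, Lemma 2.12 ff.
[Washington1997]; J. Neukirch, *Algebraic Number Theory* (1999) VII §10 Thm. (10.6) (proof) [NeukirchANT1999]; J. Tate,
*Global class field theory*, Cassels–Fröhlich Ch. VII §3.4 (`F(𝔞)ζ = ζ^{N𝔞}`) [TateGCFT1967]; J. Nekovář, Math. Ann. 302 (1995)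
(0.5) [Nekovar1995]; J.-P. Serre, *Abelian ℓ-adic representations* (1968) I §1.2 [SerreAbelianLadic1968]; K. Kato, Astérisque
295 (2004) Prop. 15.9 (p. 258) [Kato2004Asterisque]; (N2) p785484, (An) p784707.
-/

noncomputable section

open scoped NumberField
open Field NumberField IsDedekindDomain
open Literature.NumberTheory.GaloisRepresentations
open Literature.NumberTheory.EllipticCurves
open Literature.NumberTheory.LFunctions

namespace Summit.BirchSwinnertonDyer.Rank1Residual.Additive.GenusSeven

namespace LayerCharacter

/-! ## §0 Values on ideals: `heckeIdealValue` is `idealPow` -/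

section IdealValues

variable {K : Type} [Field K] [NumberField K]

/-- `idealPow` only sees the primes dividing the ideal: two prime-value functions that agree on the primes dividing
`I ≠ 0` have the same `idealPow` at `I`. [folklore] -/
theorem idealPow_congr_of_dvd (f g : HeightOneSpectrum (𝓞 K) → ℂ) {I : Ideal (𝓞 K)} (hI : I ≠ ⊥)
    (h : ∀ v : HeightOneSpectrum (𝓞 K), v.asIdeal ∣ I → f v = g v) : idealPow K f I = idealPow K g I := by
  unfold idealPow
  refine finprod_congr fun v => ?_
  by_cases hc : (Associates.mk v.asIdeal).count (Associates.mk I).factors = 0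
  · rw [hc, pow_zero, pow_zero]
  · rw [h v ((Associates.count_ne_zero_iff_dvd hI v.irreducible).mp hc)]

/-- The tree's `heckeIdealValue χ I` (finite-order Galois character, extended by zero) IS `idealPow K (heckeValueAt χ) I`
for `I ≠ 0` (the two products differ only in the bookkeeping of the exponents,
`Ideal.count_associates_factors_eq`). [cite: Nekovar1995, (0.5) p. 611] -/
theorem heckeIdealValue_eq_idealPow (χ : absoluteGaloisGroup K →ₜ* ℂˣ) {I : Ideal (𝓞 K)} (hI : I ≠ ⊥) :
    heckeIdealValue χ I = idealPow K (heckeValueAt χ) I := by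
  classical
  rw [heckeIdealValue, if_neg hI, idealPow]
  refine finprod_congr fun v => ?_
  rw [Ideal.count_associates_factors_eq hI v.isPrime v.ne_bot]

end IdealValues

/-! ## §1 The kernel: a layer character kills every `σ` whose mod-`p^{n+2}` cyclotomic character is `(p−1)`-torsion -/

section Kernel

variable {p : ℕ} [Fact p.Prime] {L : Type} [Field L] [NumberField L]
  (κ : ZpExtension ℚ p) (hp : p ≠ 2) (h2 : Module.finrank ℚ L = 2)

/-- **`χ_{p^{m+1}}(σ) = 1 ⇒ σ ∈ Gal(L̄/L_m)`** for the restricted cyclotomic `ℤ_p`-extension of the quadratic field `L`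
(`L_m = L·ℚ_m ⊂ L(μ_{p^{m+1}})`): this lineage's `NumberFieldColumn.mem_layerSubgroup_restrict_of_dvd_cyclotomicCharacter_sub_one`
read through the mod-`p^{m+1}` cyclotomic character (`modNCyclotomicCharacter_eq_toZModPow_cyclotomicCharacter`).
[cite: Washington1997, §13.1] -/
theorem mem_layerSubgroup_of_modNCyclotomicCharacter_eq_one (hκ : κ.IsCyclotomic) (m : ℕ) {M : ℕ} [NeZero M]
    (hM : M = p ^ (m + 1))
    (σ : absoluteGaloisGroup L) (hσ : modNCyclotomicCharacter L M σ = 1) :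
    σ ∈ (κ.restrictOfFinrankEqTwo hp L h2).layerSubgroup m := by
  subst hM
  haveI : NeZero (p : L) := ⟨Nat.cast_ne_zero.mpr (Fact.out : p.Prime).ne_zero⟩
  refine NumberFieldColumn.mem_layerSubgroup_restrict_of_dvd_cyclotomicCharacter_sub_one κ hκ
    (by have := (Fact.out : p.Prime).two_le; omega) _ m σ ?_
  have h1 : ((modNCyclotomicCharacter L (p ^ (m + 1)) σ : (ZMod (p ^ (m + 1)))ˣ) : ZMod (p ^ (m + 1))) = 1 := by
    rw [hσ, Units.val_one]
  rw [modNCyclotomicCharacter_eq_toZModPow_cyclotomicCharacter L p (m + 1) σ] at h1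
  have h2' : PadicInt.toZModPow (m + 1)
      (((GaloisRep.cyclotomicCharacter L p σ : ℤ_[p]ˣ) : ℤ_[p]) - 1) = 0 := by
    rw [map_sub, map_one, h1, sub_self]
  rw [← RingHom.mem_ker, PadicInt.ker_toZModPow, Ideal.mem_span_singleton] at h2'
  exact h2'

/-- `σ^{p^m} ∈ Gal(L̄/L_m)` for every `σ` (the layer group has exponent `p^m`). [cite: Washington1997, §13.1] -/
theorem pow_mem_layerSubgroup (m : ℕ) (σ : absoluteGaloisGroup L) :
    σ ^ p ^ m ∈ (κ.restrictOfFinrankEqTwo hp L h2).layerSubgroup m := by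
  rw [ZpExtension.mem_layerSubgroup, map_pow, toAdd_pow, nsmul_eq_mul, Nat.cast_pow]
  exact dvd_mul_right _ _

/-- **THE KERNEL.** A character `χ` of `Γ_L` trivial on `Gal(L̄/L_{n+1})` kills every `σ` with `χ_{p^{n+2}}(σ)^{p−1} = 1`:
`σ^{p−1} ∈ Gal(L̄/L_{n+1})` by the previous lemma and `σ^{p^{n+1}} ∈ Gal(L̄/L_{n+1})`, and `gcd(p−1, p^{n+1}) = 1`.
[cite: Washington1997, §13.1] -/
theorem apply_eq_one_of_pow_eq_one (hκ : κ.IsCyclotomic) (n : ℕ) {N : ℕ} [NeZero N] (hN : N = p ^ (n + 2))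
    (χ : absoluteGaloisGroup L →ₜ* ℂˣ)
    (hχ : ∀ σ ∈ (κ.restrictOfFinrankEqTwo hp L h2).layerSubgroup (n + 1), χ σ = 1)
    (σ : absoluteGaloisGroup L) (hσ : (modNCyclotomicCharacter L N σ) ^ (p - 1) = 1) : χ σ = 1 := by
  have hprime : p.Prime := Fact.out
  have h1 : χ σ ^ (p - 1) = 1 := by
    rw [← map_pow]
    exact hχ _ (mem_layerSubgroup_of_modNCyclotomicCharacter_eq_one κ hp h2 hκ (n + 1) hN _ (by rw [map_pow, hσ]))
  have h2' : χ σ ^ p ^ (n + 1) = 1 := by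
    rw [← map_pow]
    exact hχ _ (pow_mem_layerSubgroup κ hp h2 (n + 1) σ)
  have hcop : (p - 1).Coprime (p ^ (n + 1)) :=
    ((Nat.coprime_self_sub_left hprime.one_lt.le).mpr (Nat.coprime_one_left p)).pow_right _
  have hdvd : orderOf (χ σ) ∣ Nat.gcd (p - 1) (p ^ (n + 1)) :=
    Nat.dvd_gcd (orderOf_dvd_of_pow_eq_one h1) (orderOf_dvd_of_pow_eq_one h2')
  rw [hcop.gcd_eq_one, Nat.dvd_one] at hdvd
  exact orderOf_eq_one_iff.mp hdvd

end Kernel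

/-! ## §2 The Dirichlet avatar `χ_ℚ` (level `p^{n+2}`) of a layer character -/

section Avatar

variable {p : ℕ} [Fact p.Prime] {L : Type} [Field L] [NumberField L]

/-- Every unit `a` mod `p^k` is the mod-`p^k` cyclotomic character of some `τ ∈ Γ_ℚ` (`Gal(ℚ(μ_{p^k})/ℚ) = (ℤ/p^k)ˣ`,
tree `GaloisRep.exists_cyclotomicCharacter_toZModPow_eq`). [cite: Washington1997, Thm. 2.5] -/
theorem exists_modNCyclotomicCharacter_rat_eq (k : ℕ) {N : ℕ} [NeZero N] (hN : N = p ^ k) (a : (ZMod N)ˣ) :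
    ∃ τ : absoluteGaloisGroup ℚ, modNCyclotomicCharacter ℚ N τ = a := by
  subst hN
  obtain ⟨τ, hτ⟩ := GaloisRep.exists_cyclotomicCharacter_toZModPow_eq p k (a : ZMod (p ^ k)).val
    (ZMod.val_coe_unit_coprime a)
  refine ⟨τ, Units.ext ?_⟩
  rw [modNCyclotomicCharacter_eq_toZModPow_cyclotomicCharacter ℚ p k τ, hτ, ZMod.natCast_zmod_val]

/-- For `[L : ℚ] = 2` (Galois) every EVEN power of an element of `Γ_ℚ` is a restriction from `Γ_L`
(`Γ_ℚ / res(Γ_L)` has order `2`, tree `RelModel.pow_finrank_mem_galRange`). [folklore] -/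
theorem exists_absGaloisRestrict_eq_pow [IsGalois ℚ L] (h2 : Module.finrank ℚ L = 2) (τ : absoluteGaloisGroup ℚ)
    {E : ℕ} (hE : Even E) :
    ∃ σ : absoluteGaloisGroup L, absGaloisRestrict ℚ L σ = τ ^ E := by
  obtain ⟨e, rfl⟩ := hE
  have h := RelModel.pow_finrank_mem_galRange (K := ℚ) L (τ ^ e)
  rw [h2, ← pow_mul, mul_two] at h
  exact (mem_galRange_iff (K := ℚ) L _).mp h

/-- The exponent `E = (p−1)·e` with `(p−1)e ≡ 1 (mod p^{n+1})`: raising to the `E`-th power is the projection of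
`(ℤ/p^{n+2})ˣ = μ_{p−1} × U₁` onto its `p`-Sylow `U₁`. [cite: Washington1997, §13.1] -/
theorem exists_exponent (hp : p ≠ 2) (n : ℕ) : ∃ E : ℕ, Even E ∧ 1 ≤ E ∧ p ^ (n + 1) ∣ E - 1 := by
  have hprime : p.Prime := Fact.out
  haveI : Fact (1 < p ^ (n + 1)) := ⟨Nat.one_lt_pow (Nat.succ_ne_zero n) hprime.one_lt⟩
  have hcop : (p - 1).Coprime (p ^ (n + 1)) :=
    ((Nat.coprime_self_sub_left hprime.one_lt.le).mpr (Nat.coprime_one_left p)).pow_right _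
  set E : ℕ := (p - 1) * ((p - 1 : ℕ) : ZMod (p ^ (n + 1)))⁻¹.val with hE
  have hE1 : (E : ZMod (p ^ (n + 1))) = 1 := by
    rw [hE, Nat.cast_mul, ZMod.natCast_zmod_val, ZMod.coe_mul_inv_eq_one _ hcop]
  have h1 : 1 ≤ E := by
    by_contra h0
    have h0' : E = 0 := by omega
    rw [h0', Nat.cast_zero] at hE1
    exact zero_ne_one hE1
  refine ⟨E, (hprime.even_sub_one hp).mul_right _, h1, ?_⟩
  rw [← ZMod.natCast_eq_zero_iff, Nat.cast_sub h1, hE1, Nat.cast_one, sub_self]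

/-- **THE DIRICHLET AVATAR OF A LAYER CHARACTER** (Washington §13.1 / Ch. 3: characters of `Gal(L·ℚ_{n+1}/L) ≅ Gal(ℚ_{n+1}/ℚ)`
ARE Dirichlet characters of level `p^{n+2}` trivial on `μ_{p−1}`).  For `L` quadratic (Galois), `κ` a cyclotomic
`ℤ_p`-datum of `ℚ` (`p` odd) and a continuous `χ : Γ_L → ℂˣ` trivial on `Gal(L̄/L_{n+1})` (the `(n+1)`-st layer of
`κ|_L`), there is a Dirichlet character `θ` mod `N = p^{n+2}`, trivial on the `(p−1)`-torsion, with
`χ(σ) = θ(χ_N(σ))` for EVERY `σ ∈ Γ_L` (`χ_N` the mod-`N` cyclotomic character of `Γ_L`).  Construction: `θ(a) = χ(σ_a)` for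
any `σ_a ∈ Γ_L` restricting to `τ_a^E`, `χ_N(τ_a) = a` (`E` of `exists_exponent`); well defined and multiplicative by THE
KERNEL (`apply_eq_one_of_pow_eq_one`). [cite: Washington1997, §13.1 and Ch. 3 (pp. 19–21)] -/
theorem exists_dirichletCharacter [IsGalois ℚ L] (κ : ZpExtension ℚ p) (hκ : κ.IsCyclotomic) (hp : p ≠ 2)
    (h2 : Module.finrank ℚ L = 2) (n : ℕ) {N : ℕ} [NeZero N] (hN : N = p ^ (n + 2)) (χ : absoluteGaloisGroup L →ₜ* ℂˣ)
    (hχ : ∀ σ ∈ (κ.restrictOfFinrankEqTwo hp L h2).layerSubgroup (n + 1), χ σ = 1) :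
    ∃ θ : DirichletCharacter ℂ N, (∀ a : (ZMod N)ˣ, a ^ (p - 1) = 1 → θ a = 1) ∧
      ∀ σ : absoluteGaloisGroup L, ((χ σ : ℂˣ) : ℂ) = θ (modNCyclotomicCharacter L N σ) := by
  have hprime : p.Prime := Fact.out
  haveI : NeZero (p : L) := ⟨Nat.cast_ne_zero.mpr hprime.ne_zero⟩
  obtain ⟨E, hEven, h1E, c, hc⟩ := exists_exponent (p := p) hp n
  have hE : E = p ^ (n + 1) * c + 1 := by omega
  -- the kernel
  have hker : ∀ σ : absoluteGaloisGroup L, (modNCyclotomicCharacter L N σ) ^ (p - 1) = 1 → χ σ = 1 :=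
    fun σ hσ => apply_eq_one_of_pow_eq_one κ hp h2 hκ n hN χ hχ σ hσ
  -- `a ^ ((p^{n+1} c) (p-1)) = 1` (`φ(p^{n+2}) = p^{n+1}(p-1)`)
  have htot : ∀ a : (ZMod N)ˣ, (a ^ (p ^ (n + 1) * c)) ^ (p - 1) = 1 := fun a => by
    rw [← pow_mul, mul_assoc, mul_comm c, ← mul_assoc, pow_mul, ← Nat.totient_prime_pow_succ hprime, ← hN,
      ZMod.pow_totient, one_pow]
  have hEpow : ∀ a : (ZMod N)ˣ, (a ^ E) ^ (p - 1) = a ^ (p - 1) := fun a => by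
    rw [hE, pow_succ, mul_pow, htot, one_mul]
  -- the section `a ↦ σ_a` with `χ_N(σ_a) = a ^ E`
  have hsec : ∀ a : (ZMod N)ˣ, ∃ σ : absoluteGaloisGroup L, modNCyclotomicCharacter L N σ = a ^ E := by
    intro a
    obtain ⟨τ, hτ⟩ := exists_modNCyclotomicCharacter_rat_eq (p := p) (n + 2) hN a
    obtain ⟨σ, hσ⟩ := exists_absGaloisRestrict_eq_pow h2 τ hEven
    refine ⟨σ, ?_⟩
    rw [← modNCyclotomicCharacter_absGaloisRestrict ℚ L N σ, hσ, map_pow, hτ]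
  choose sec hsec using hsec
  -- `χ ∘ sec` is a homomorphism
  have hmul : ∀ a b : (ZMod N)ˣ, χ (sec (a * b)) = χ (sec a) * χ (sec b) := by
    intro a b
    rw [← map_mul, eq_comm, ← mul_inv_eq_one, ← map_inv, ← map_mul]
    refine hker _ ?_
    rw [map_mul, map_inv, map_mul, hsec, hsec, hsec, ← mul_pow, mul_inv_cancel, one_pow]
  have hone : χ (sec 1) = 1 := by
    refine hker _ ?_
    rw [hsec, one_pow, one_pow]
  let θu : (ZMod N)ˣ →* ℂˣ := { toFun := fun a => χ (sec a), map_one' := hone, map_mul' := hmul }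
  refine ⟨MulChar.ofUnitHom θu, fun a ha => ?_, fun σ => ?_⟩
  · -- trivial on the `(p-1)`-torsion
    rw [← MulChar.coe_toUnitHom, MulChar.toUnitHom_eq, MulChar.ofUnitHom_eq, Equiv.apply_symm_apply]
    change ((χ (sec a) : ℂˣ) : ℂ) = 1
    rw [hker (sec a) (by rw [hsec, hEpow, ha]), Units.val_one]
  · -- `χ σ = θ (χ_N σ)`
    rw [← MulChar.coe_toUnitHom, MulChar.toUnitHom_eq, MulChar.ofUnitHom_eq, Equiv.apply_symm_apply]
    change ((χ σ : ℂˣ) : ℂ) = ((χ (sec (modNCyclotomicCharacter L N σ)) : ℂˣ) : ℂ)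
    congr 1
    rw [eq_comm, ← mul_inv_eq_one, ← map_inv, ← map_mul]
    refine hker _ ?_
    rw [map_mul, map_inv, hsec, ← pow_sub_one_mul (by omega : E ≠ 0) (modNCyclotomicCharacter L N σ),
      mul_inv_cancel_right, show E - 1 = p ^ (n + 1) * c by omega, htot]

end Avatar

/-! ## §3 Primitivity ⟺ order: the avatar is PRIMITIVE of level `p^{n+2}` when `χ` takes a primitive `p^{n+1}`-th root of unity as a value -/

section Primitive

variable {p : ℕ} [Fact p.Prime] {L : Type} [Field L] [NumberField L]

/-- **Primitivity of the avatar from the order of `χ`** (Washington §13.1: a character of `Gal(ℚ_{n+1}/ℚ) ≅ ℤ/p^{n+1}` of exact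
order `p^{n+1}` has conductor `p^{n+2}`).  If `χ(σ) = θ(χ_N(σ))` on `Γ_L` (`N = p^{n+2}`) and SOME value `χ(γ)` is a primitive
`p^{n+1}`-th root of unity, then `θ` is primitive: otherwise `θ` factors through level `p^{n+1}` (its conductor is a power
of `p`), so it kills `χ_N(γ)^{p^n (p−1)}` (a unit `≡ 1 (mod p^{n+1})`, `φ(p^{n+1}) = p^n(p−1)`), i.e. `χ(γ)^{p^n(p−1)} = 1` —
impossible as `p^{n+1} ∤ p^n(p−1)`. [cite: Washington1997, §13.1 and Ch. 3 (p. 21, conductor)] -/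
theorem isPrimitive_of_isPrimitiveRoot (n : ℕ) {N : ℕ} [NeZero N] (hN : N = p ^ (n + 2))
    (χ : absoluteGaloisGroup L →ₜ* ℂˣ) (θ : DirichletCharacter ℂ N)
    (hθ : ∀ σ : absoluteGaloisGroup L, ((χ σ : ℂˣ) : ℂ) = θ (modNCyclotomicCharacter L N σ))
    {γ : absoluteGaloisGroup L} (hγ : IsPrimitiveRoot ((χ γ : ℂˣ) : ℂ) (p ^ (n + 1))) : θ.IsPrimitive := by
  have hprime : p.Prime := Fact.out
  have h2le := hprime.two_le
  subst hN
  by_contra hprim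
  rw [DirichletCharacter.isPrimitive_def] at hprim
  -- the conductor is `p^j` with `j ≤ n + 1`
  obtain ⟨j, hj, hcond⟩ := (Nat.dvd_prime_pow hprime).mp θ.conductor_dvd_level
  have hjle : j ≤ n + 1 := by
    by_contra h
    have hj' : j = n + 2 := by omega
    exact hprim (by rw [hcond, hj'])
  have hMN : p ^ (n + 1) ∣ p ^ (n + 2) := pow_dvd_pow p (Nat.le_succ _)
  have hfac : θ.FactorsThrough (p ^ (n + 1)) := by
    have h0 : θ.FactorsThrough (p ^ j) := hcond ▸ θ.factorsThrough_conductor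
    exact DirichletCharacter.FactorsThrough.mono θ h0 (pow_dvd_pow p hjle) hMN
  -- the unit `u = χ_N(γ)^{p^n (p-1)}` maps to `1` mod `p^{n+1}`
  set a : (ZMod (p ^ (n + 2)))ˣ := modNCyclotomicCharacter L (p ^ (n + 2)) γ with ha
  haveI : NeZero (p ^ (n + 1)) := ⟨pow_ne_zero _ hprime.ne_zero⟩
  have hu : a ^ (p ^ n * (p - 1)) ∈ (ZMod.unitsMap hMN).ker := by
    rw [MonoidHom.mem_ker, map_pow, ← Nat.totient_prime_pow_succ hprime, ZMod.pow_totient]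
  have hker := (DirichletCharacter.factorsThrough_iff_ker_unitsMap hMN).mp hfac hu
  rw [MonoidHom.mem_ker, map_pow] at hker
  -- hence `χ(γ)^{p^n (p-1)} = 1`
  have hval : ((χ γ : ℂˣ) : ℂ) ^ (p ^ n * (p - 1)) = 1 := by
    rw [hθ γ, ← ha, ← MulChar.coe_toUnitHom, ← Units.val_pow_eq_pow_val, hker, Units.val_one]
  have hdvd := (hγ.pow_eq_one_iff_dvd _).mp hval
  rw [pow_succ, Nat.mul_dvd_mul_iff_left (pow_pos hprime.pos n)] at hdvd
  have := Nat.le_of_dvd (Nat.sub_pos_of_lt hprime.one_lt) hdvd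
  omega

end Primitive

/-! ## §4 Frobenius values: `χ(Frob_v) = θ(N v)` off `p`, so `χ(𝔞) = θ(N𝔞)` for `𝔞` prime to `p` -/

section Frobenius

variable {p : ℕ} {L : Type} [Field L] [NumberField L]

omit [NumberField L] in
/-- `N = p^k ∉ 𝔓` for a prime `𝔓` of `\bar ℤ_L` above a place `v ∌ p`. [folklore] -/
theorem natCast_not_mem_of_mem_primesAbove (k : ℕ) {N : ℕ} (hN : N = p ^ k) {v : HeightOneSpectrum (𝓞 L)}
    (hv : (p : 𝓞 L) ∉ v.asIdeal) {𝔓 : Ideal (absIntegers (𝓞 L) L)} (h𝔓 : 𝔓 ∈ v.primesAbove) :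
    (N : absIntegers (𝓞 L) L) ∉ 𝔓 := by
  haveI : 𝔓.IsPrime := h𝔓.1
  intro h
  apply hv
  rw [h𝔓.2.over, Ideal.mem_under, map_natCast]
  rw [hN, Nat.cast_pow] at h
  exact Ideal.IsPrime.mem_of_pow_mem inferInstance k h

/-- A character `χ = θ ∘ χ_N` (`N = p^k`) is UNRAMIFIED (as a rank-one Artin representation) at every place `v ∌ p`: the
mod-`N` cyclotomic character kills the inertia groups above `v` (`modNCyclotomicCharacter_eq_one_of_mem_inertia`).
[cite: Washington1997, Ch. 3 (p. 21: p ramifies in the field of χ iff p ∣ f_χ)] -/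
theorem isUnramifiedAt_of_eq_dirichlet (k : ℕ) {N : ℕ} [NeZero N] (hN : N = p ^ k)
    (χ : absoluteGaloisGroup L →ₜ* ℂˣ) (θ : DirichletCharacter ℂ N)
    (hθ : ∀ σ : absoluteGaloisGroup L, ((χ σ : ℂˣ) : ℂ) = θ (modNCyclotomicCharacter L N σ))
    {v : HeightOneSpectrum (𝓞 L)} (hv : (p : 𝓞 L) ∉ v.asIdeal) :
    GaloisRep.IsUnramifiedAt v (FramedArtinRep.toArtinRep (FramedRep.ofCharacter χ)) := by
  rw [Gross2004.isUnramifiedAt_ofCharacter_iff]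
  intro 𝔓 h𝔓 τ hτ
  haveI : 𝔓.IsPrime := h𝔓.1
  have h1 := modNCyclotomicCharacter_eq_one_of_mem_inertia (natCast_not_mem_of_mem_primesAbove k hN hv h𝔓) hτ
  apply Units.val_injective
  rw [hθ τ, h1, Units.val_one, Units.val_one, map_one]

/-- **`χ(Frob_v) = θ(N v)` off `p`**: for `χ = θ ∘ χ_N` the tree's extended-by-zero value `heckeValueAt χ v` at a place
`v ∌ p` is `θ(N v mod N)` = the tree's `normCharValue θ v` (Artin reciprocity for `L(μ_N)/L` through the norm:
`χ_N(Frob_𝔓) = N v`, tree `modNCyclotomicCharacter_eq_residueCard_of_isArithFrobAt`).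
[cite: Washington1997, Thm. 2.5 and Lemma 2.12 ff. (Frob ↦ N v)] [cite: NeukirchANT1999, Ch. VII §10 Thm. (10.6) (proof)] -/
theorem heckeValueAt_eq_normCharValue (k : ℕ) {N : ℕ} [NeZero N] (hN : N = p ^ k)
    (χ : absoluteGaloisGroup L →ₜ* ℂˣ) (θ : DirichletCharacter ℂ N)
    (hθ : ∀ σ : absoluteGaloisGroup L, ((χ σ : ℂˣ) : ℂ) = θ (modNCyclotomicCharacter L N σ))
    {v : HeightOneSpectrum (𝓞 L)} (hv : (p : 𝓞 L) ∉ v.asIdeal) : heckeValueAt χ v = normCharValue θ v := by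
  obtain ⟨𝔓, h𝔓⟩ := v.primesAbove_nonempty
  obtain ⟨σ, hσ⟩ := HeightOneSpectrum.exists_isArithFrobAt_of_mem_primesAbove_holds h𝔓
  rw [Gross2004.heckeValueAt_eq_of_isUnramifiedAt χ (isUnramifiedAt_of_eq_dirichlet k hN χ θ hθ hv) h𝔓 hσ, hθ σ,
    modNCyclotomicCharacter_eq_residueCard_of_isArithFrobAt h𝔓 (natCast_not_mem_of_mem_primesAbove k hN hv h𝔓) hσ,
    normCharValue_apply]
  rfl

/-- **`χ(𝔞) = θ(N𝔞)` for `𝔞 ≠ 0` prime to `p`**: the tree's `heckeIdealValue χ 𝔞` (product of the `heckeValueAt` over the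
prime factorisation) of an ideal none of whose prime factors contains `p` is `θ(N𝔞 mod N)` (`idealPow_normCharValue`).
[cite: TateGCFT1967, §3.4 Cor. (F(𝔞)ζ = ζ^{N𝔞})] [cite: Nekovar1995, (0.5) p. 611] -/
theorem heckeIdealValue_eq (k : ℕ) {N : ℕ} [NeZero N] (hN : N = p ^ k)
    (χ : absoluteGaloisGroup L →ₜ* ℂˣ) (θ : DirichletCharacter ℂ N)
    (hθ : ∀ σ : absoluteGaloisGroup L, ((χ σ : ℂˣ) : ℂ) = θ (modNCyclotomicCharacter L N σ))
    {I : Ideal (𝓞 L)} (hI : I ≠ ⊥) (hIp : ∀ v : HeightOneSpectrum (𝓞 L), v.asIdeal ∣ I → (p : 𝓞 L) ∉ v.asIdeal) :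
    heckeIdealValue χ I = θ (Ideal.absNorm I) := by
  rw [heckeIdealValue_eq_idealPow χ hI,
    idealPow_congr_of_dvd (heckeValueAt χ) (normCharValue θ) hI
      (fun v hv => heckeValueAt_eq_normCharValue k hN χ θ hθ (hIp v hv)),
    idealPow_normCharValue θ hI]

end Frobenius

end LayerCharacter

end Summit.BirchSwinnertonDyer.Rank1Residual.Additive.GenusSeven

end
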